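import Mathlib
import Literature.Analysis.FluidPDE.VectorCalculus

/-!
# Clause 13-R, route (ii′) item (c), MODEL REDUCTION: the explicit adjoint weights of `…Clause13RAdjointOperator` on a STRAIGHT axis
# (crux `Clause13RNearStraightL`, stmt-NavierStokesRegularity-23612; line `rate_bordered_split`, STUB R `stub_rateRow13RFlat`)

Route `FilamentSkeletonRss`, Variant A1R.  The adjoint operator `(D^*ψ)_k` landed in `…Clause13RAdjointOperator` / `…Clause13RClausePairing` has, per
pair of filaments, the three weights (kernels `K_p = ((‖X_jτ − X_kσ‖² + core)^{p/2})⁻¹`)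
`A: (−3K₅⟪φ, X′u × (Xσ − Xu)⟫)•(Xσ − Xu) + K₃•(φ × X′u)`, `B: (3K₅⟪φτ, X′σ × (Xτ − Xσ)⟫)•(Xτ − Xσ) − K₃•(φτ × X′σ)`,
`C: (3⟪Xτ − Xσ, X′σ⟫K₅⁰)•(φτ × (Xσ − Xτ)) + K₃⁰•(φτ × X′σ)`.
On a STRAIGHT axis `X u = p + u•d` (the model of census item (c), memo STRUCTURE-23612-conformal-cokernel-leafhand8-g1.md; the zeroth iterate of every
construction) `X′ ≡ d` and `X′ × (Xσ − Xu) = (σ − u)•(d × d) = 0`, so ALL `K₅`-TERMS OF `A` AND `B` VANISH and every weight is a scalar multiple of `φ × d`: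

* `A`-integrand `= K₃•(φ × d)`, `B`-integrand `= −K₃•(φτ × d)`, `C`-integrand `= (K₃⁰ − 3(τ−σ)²‖d‖²K₅⁰)•(φτ × d)`
  (`straight_A_integrand`, `straight_B_integrand`, `straight_C_integrand`; `deriv_line`), i.e. the self part of the model adjoint operator is
  `φ ↦ (∫K₃)•(φ(σ) × d) − ∫_S [2K₃(τ−σ) − 3(τ−σ)²‖d‖²K₅(τ−σ)]•(φ(τ) × d) dτ` — the transpose of the Taylor-remainder (LIA) operator of
  `…Clause13RTaylorRemainderSymmetry` / `…Clause13RAffineAnnihilator` (kernel `(2a − s²)/(s² + a)^{5/2}` for `‖d‖ = 1`, odd first moment zero: affine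
  normal weights are annihilated in the interior of the ball), to which the local terms `½φ + α e₃ × φ + (wφ)′` are added.

Hand `leafhand-ns-filamentskeletonrs-10-g0` (LAND-ONLY); `--supports stmt-NavierStokesRegularity-23612` helper.  HONEST FRAMING: algebra for the MODEL of a
HYPOTHETICAL filament skeleton on the NEGATIVE side of a MODEL blow-up route; STUB R is NOT proved here and nothing in this file bears on Navier–Stokes
regularity or blow-up.
-/

noncomputable section

open MeasureTheory Filter Topology Set
open scoped RealInnerProductSpace InnerProductSpace
open Literature.Analysis.FluidPDE

namespace Summit.NavierStokesRegularity.NavierStokesRegularity.Theorems.Clause13RAdjointStraightModel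
set_option linter.dupNamespace false

/-- `φ × (r•d) = r•(φ × d)`. [folklore] -/
theorem cross_smul_right (φ d : EuclideanSpace ℝ (Fin 3)) (r : ℝ) : cross φ (r • d) = r • cross φ d := by
  rw [← crossCLM_apply, map_smul, crossCLM_apply]

/-- Chord of a line: `(p + σ•d) − (p + u•d) = (σ − u)•d`. [folklore] -/
theorem line_chord (p d : EuclideanSpace ℝ (Fin 3)) (σ u : ℝ) : (p + σ • d) - (p + u • d) = (σ - u) • d := by
  rw [sub_smul]; abel

/-- The tangent of a line: `deriv (u ↦ p + u•d) = d`. [folklore] -/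
theorem deriv_line (p d : EuclideanSpace ℝ (Fin 3)) (u : ℝ) : deriv (fun u : ℝ => p + u • d) u = d := by
  have h : HasDerivAt (fun u : ℝ => p + u • d) ((1 : ℝ) • d) u := ((hasDerivAt_id u).smul_const d).const_add p
  rw [one_smul] at h
  exact h.deriv

/-- **`A`-integrand on a straight axis**: the `K₅` term vanishes, `= K₃•(φ × d)`. [folklore] -/
theorem straight_A_integrand (p d φ : EuclideanSpace ℝ (Fin 3)) (σ u k5 k3 : ℝ) :
    (-3 * k5 * ⟪φ, cross d ((p + σ • d) - (p + u • d))⟫) • ((p + σ • d) - (p + u • d)) + k3 • cross φ d = k3 • cross φ d := by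
  -- `d × (r•d) = 0` (the tree's `TransverseReductionRCensus.cross_smul_self`, inlined to keep this file route-independent)
  have h0 : cross d ((σ - u) • d) = 0 := by
    rw [cross_smul_right]
    have : cross d d = 0 := by simp [cross]
    rw [this, smul_zero]
  rw [line_chord, h0, inner_zero_right, mul_zero, zero_smul, zero_add]

/-- **`B`-integrand on a straight axis**: the `K₅` term vanishes, `= −K₃•(φτ × d)`. [folklore] -/
theorem straight_B_integrand (p d φ : EuclideanSpace ℝ (Fin 3)) (τ σ k5 k3 : ℝ) :
    (3 * k5 * ⟪φ, cross d ((p + τ • d) - (p + σ • d))⟫) • ((p + τ • d) - (p + σ • d)) - k3 • cross φ d = -(k3 • cross φ d) := by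
  have h0 : cross d ((τ - σ) • d) = 0 := by
    rw [cross_smul_right]
    have : cross d d = 0 := by simp [cross]
    rw [this, smul_zero]
  rw [line_chord, h0, inner_zero_right, mul_zero, zero_smul, zero_sub]

/-- **`C`-integrand on a straight axis**: `= (K₃⁰ − 3(τ−σ)²‖d‖²K₅⁰)•(φτ × d)`. [folklore] -/
theorem straight_C_integrand (p d φ : EuclideanSpace ℝ (Fin 3)) (τ σ k5 k3 : ℝ) :
    (3 * ⟪(p + τ • d) - (p + σ • d), d⟫ * k5) • cross φ ((p + σ • d) - (p + τ • d)) + k3 • cross φ d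
      = (k3 - 3 * (τ - σ) ^ 2 * ‖d‖ ^ 2 * k5) • cross φ d := by
  rw [line_chord, line_chord, cross_smul_right, inner_smul_left, real_inner_self_eq_norm_sq, smul_smul, ← add_smul]
  congr 1
  simp only [conj_trivial]
  ring

/-- The chord length on a straight axis: `‖(p + τ•d) − (p + σ•d)‖² = (τ − σ)²‖d‖²` (so the kernels are even functions of `τ − σ`). [folklore] -/
theorem norm_line_chord_sq (p d : EuclideanSpace ℝ (Fin 3)) (τ σ : ℝ) : ‖(p + τ • d) - (p + σ • d)‖ ^ 2 = (τ - σ) ^ 2 * ‖d‖ ^ 2 := by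
  rw [line_chord, norm_smul, Real.norm_eq_abs, mul_pow, sq_abs]

end Summit.NavierStokesRegularity.NavierStokesRegularity.Theorems.Clause13RAdjointStraightModel

end
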